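import Mathlib
import HarnessLib

/-!
# `OneSidedDegreeLadder` — norm-form slices of a Bateman–Horn polynomial (hand (a): DATA DEFINITIONS ONLY)

decomp-parity node B1.1.5 «NormFormSliceLadder» (lens-1 «grading / quantitative ladder» g8; kernel
`HOME/decomp-parity-lens-1/g8/NormFormSliceLadder.lean` §1; critic CLEARED CRITIC-LEDGER row 96; writer DECISION
2026-08-30T12:35:37Z): a CONSEQUENCE NOTCH beneath the record leaf `OneSidedDegreeLadder.LowerNonlinear`
(stmt-Parity-25177), zero distance credit.  D-0026 split: this file holds the DATA definitions only (no `def … : Prop`);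
the theorems live in `OneSidedDegreeLadderNormFormSlicesIdentity.lean` (the slice identities `f(a) = N(a − ω)` and
`N(x − yω) = Σ aᵢ xⁱ yⁿ⁻ⁱ`) and `OneSidedDegreeLadderNormFormSlices.lean` (necessity, exactness, the cells of the ladder).

For `f ∈ ℤ[X]` let `ω` be the class of `X` in `AdjoinRoot f = ℤ[X]/(f)` (for monic `f` of degree `n` a free ℤ-module
with power basis `1, ω, …, ωⁿ⁻¹`, Mathlib `AdjoinRoot.powerBasis'`) and `N = Algebra.norm ℤ`.
* `sliceElt f m x = Σ_{i<m} xᵢ ωⁱ` and `sliceNorm f m x = N(sliceElt f m x)`: the `m`-variable INCOMPLETE NORM FORM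
  of `f` (Maynard's `N_K(x₁ + x₂ω + ⋯ + x_{n−k}ω^{n−k−1})` with `m = n − k`), a form of degree `n` in `m` variables
  whose values `≤ x` number `≍ x^{m/n}` — the grade of the ladder is the density `δ = m/n`;
* `slicePrimes f m`: the prime values of the `m`-slice;
* `affinePt a = (a, −1, 0, …)`, the element `a − ω` (`N(a − ω) = f(a)`: Bateman–Horn for `f` is the affine line,
  `δ = 1/n`), and `binaryPt x y = (x, −y, 0, …)`, the element `x − yω` (`N(x − yω)` = the binary form of `f`, `δ = 2/n`).
-/

open Finset Polynomial

namespace Summit.Parity.BatemanHorn.Theses.OneSidedDegreeLadder.NormFormSlice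

noncomputable section

/-- The slice element `x₀ + x₁ω + ⋯ + x_{m−1}ω^{m−1}` of `ℤ[X]/(f)`, `ω` = the class of `X` (coefficient vector
`x : ℕ → ℤ`, only `x 0, …, x (m−1)` are used). -/
def sliceElt (f : ℤ[X]) (m : ℕ) (x : ℕ → ℤ) : AdjoinRoot f :=
  ∑ i ∈ range m, algebraMap ℤ (AdjoinRoot f) (x i) * AdjoinRoot.root f ^ i

/-- The `m`-variable INCOMPLETE NORM FORM of `f`: `N_{ℤ[ω]/ℤ}(x₀ + x₁ω + ⋯ + x_{m−1}ω^{m−1})` (for monic `f` of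
degree `n` a form of degree `n` in `m` variables; Maynard's `N_K(a₁, …, a_{n−k})` with `m = n − k`). -/
def sliceNorm (f : ℤ[X]) (m : ℕ) (x : ℕ → ℤ) : ℤ :=
  Algebra.norm ℤ (sliceElt f m x)

/-- The prime values of the `m`-slice of the norm form of `f`. -/
def slicePrimes (f : ℤ[X]) (m : ℕ) : Set ℕ :=
  {p : ℕ | p.Prime ∧ ∃ x : ℕ → ℤ, sliceNorm f m x = p}

/-- The affine point `(a, −1, 0, 0, …)`: the bottom rung, `f` itself (`sliceNorm_affinePt`). -/
def affinePt (a : ℤ) : ℕ → ℤ := fun i => if i = 0 then a else if i = 1 then -1 else 0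

/-- The binary point `(x, −y, 0, 0, …)`: the element `x − yω`, i.e. the classical binary form of `f`
(`sliceNorm_binaryPt`). -/
def binaryPt (x y : ℤ) : ℕ → ℤ := fun i => if i = 0 then x else if i = 1 then -y else 0

end

end Summit.Parity.BatemanHorn.Theses.OneSidedDegreeLadder.NormFormSlice
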